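import Summits.BirchSwinnertonDyer.Rank1Residual.F1Sign2.ResidueTraceGoverningLawAtTwo
import Summits.BirchSwinnertonDyer.Rank1Residual.F1Sign2.GenusClassSwitchingAtTwo
import HarnessLib.Audit.Tags
import HarnessLib

/-!
# Cell `bsd-f1-sign2` — descent / visibility lens (planner `-desc` g23 → g25; MEMO-desc §32 + §32-add(R196)): DESC-32 «THE ANALYTIC DEPTH BIT IS A PRIME COEFFICIENT OF A
# WEIGHT-2 MODULAR FORM MOD 2; THE GENUS CLASS HAS ONE GOVERNING FIELD» (carriers `InGenusClassAtTwo`, `DoorResidueDegree`; DESC-32-G `GenusClassGoverningFieldAtTwo`,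
# DESC-32-B `GenusClassDepthBitFrobenianAtTwo`, -desc's glue `frobenian_of_governing`, DESC-32-P `GenusClassShaAnSquareClassAtTwo`; REF1 §196's BC7 certificates
# BC7-3…6 live in the sibling `GenusClassGoverningFieldAtTwoKernel.lean`)

STATEMENTS + -desc's one glue theorem (typer -ty g19).  Source: `HOME/MEMO-desc-data/g25/lean/Sketch32v2.lean` **1a300b859d81d8de** (131 l., ns flat `…F1Sign2`; -desc g25's BC7
`bc7_32v2.out` 42dc…: P1/P2/P2h/P5 ok) = -desc g23's `Sketch32.lean` **65c8ee5d2ca5b6b5** (the text REF1 audited in §196, `HOME/REF1-data/b196/Sketch32.lean`; REF1's verbatim copy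
`HOME/REF1-data/b196/lean/Probe196a.lean` **a338928907dbf390** under `…F1Sign2.REF1s196a`, farm rc 0 · exactly 3 sorries) WITH EXACTLY REF1's MANDATORY R196a CURRENCY RE-TYPE of
DESC-32-G/B applied by -desc (builder-verified byte-for-byte: the G/B conclusions `∃ n : ℕ, shaAn W' = (n : ℂ) ∧ (Odd (a_p W) → (16 ∣ n ↔ (c ↔ f_p = 6))) ∧ (TwoTorsionSplitModP
W p → (Odd n ↔ f_p = 4))` became `∃ x : ℚ, shaAn W' = (x : ℂ) ∧ x ≠ 0 ∧ (Odd (a_p W) → (4 ≤ padicValRat 2 x ↔ (c ↔ f_p = 6))) ∧ (FrobTwoSplitAt W p → (padicValRat 2 x = 0 ↔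
f_p = 4))` — REF1 §196 R196a's replacement text VERBATIM, with R196e's ONE tree name `FrobTwoSplitAt` (`F1Sign2/GenusClassSwitchingAtTwo.lean` l.81, the -desc §33 port p724225;
Sketch32 v1's duplicate carrier `TwoTorsionSplitModP` is dropped) and R196b's wording («`(Δ_W/p) = +1` on the class ALWAYS», not «when admissible primes exist»); every
other byte of the carriers, of DESC-32-P and of the glue is Sketch32 v1 = Probe196a VERBATIM).  So the §196 PORT GATE («Sketch32 G/B GATED on R196a, P un-gated», R196e) is
SERVED; -desc asked REF1 g20 for a re-type check of Sketch32v2 vs §196 (INBOX 2026-08-29T15:29:36Z) — this file is that re-type, nothing else.  WHY R196a (REF1 §196 FINDINGS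
32 (i), kernel `bc7_32G_forces_integrality` / `bc7_32B_forces_integrality` on the v1 text): the `∃ n : ℕ` currency made G and B assert ALL-PRIME INTEGRALITY (and `≥ 0`) of
`#Ш_an` of every rank-0 twin over the whole genus class — BSD-strength content smuggled into a 2-adic law; the `ℚ`/`padicValRat 2` form keeps exactly the two bits and is a
pure WEAKENING of the v1 form (dictionary `bc7_nat_to_rat_currency`, kernel file).  TAGS per R196e: G, B `@[conjecture]`; P plain `def … : Prop`; glue a `theorem` (proved,
5 lines).  CITE TAGS (typer): -desc's prose brackets are split one key per tag in the tree's format — `Waldspurger1981Fourier` (Thm. 1), `BaruchMao2007` (Thm. 1.1; the key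
now EXISTS — REF2 v53 §5.5 had it absent), `Carayol1994` (Thm. 3), `Chenevier2014`, `Morgan2023KummerGeneric` (Prop. 19, 24, 26, 31, Cor. 34) — locators are -desc's, keys
verified in `references.bib`; REF2 v53 §5.5 trap T53-2 observed (nothing here hangs on `OnoSkinner1998`).
GRADES (REF1-AUDIT §196, `HOME/REF1-AUDIT-v1.md`; evidence `HOME/REF1-data/b196/`): **DESC-32-G SURVIVES as `@[conjecture]`** (BSD₂-prediction row with a candidate
mechanism; R196a mandatory before any non-«⟸BSD₂» billing — applied); **DESC-32-B SURVIVES** (`@[conjecture]`; finitely unfalsifiable alone, content = G's; same R196a —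
applied); **DESC-32-P SURVIVES, support-grade** (R196f wording: parity-CONSTANCY of `v₂(#Ш_an)` on the class is Waldspurger–(Baruch–Mao/Pal) print, EVENNESS needs one
anchor twin per class (a per-curve exact modular-symbol value or DESC-30-N₀) — as a `∀ W` typed row it is a conjecture-grade SUPPORT statement, not a theorem); glue CLEAN;
carriers CLEAN (BC7-4/5/6: `DoorResidueDegree M q 0` is never satisfiable, the class pins `p ≡ 7 (mod 8)`, `p ≠ 2 ∧ p.Prime` so no junk `frobeniusTrace 2`); KILLED none.
(A3) branch inhabited: 446a1 and the 23 other ENGINE-40 curves satisfy `OnOddBranchRankOneAtTwo` by -desc's census (REF1 did not re-verify the `∀ d` clause beyond the data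
range).  REF2-PLACEMENT v53 §5 (R32a; supersedes v53 §1) GRADES OF RECORD for §32: θ-trick (b) IN PRINT (Serre 1976 «Divisibilité» (4.13)(a) — 1976 priority; Ono–Skinner
1998 Invent.; Ono 2001 L3.2/3.3); key congruence (e) IN PRINT (Ono 2001 L3.3(1) verbatim in valuation form); B32 = PRINT-ASSEMBLY / corollary-candidate of print (Serre 1976
Thm 4.7 / Ono 2001 Thm 2.2 + Waldspurger 1981 Thm 1 + class-constancy (B4)) — «not a cell theorem-candidate in the novelty sense»; (P2) variant of a printed computation;
determinant-law step IN PRINT as used (Carayol 1994 / Chenevier 2014; CKW 2013 for the Artinian phrasing); §32.1 split-prime trichotomy PRINT-ASSEMBLY; (H_min) «class minimum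
attained at a prime» VARIANT-CANDIDATE, open per curve (measured for 446a1 to 6 000 only); C32 (`R_W ≅ 𝔽₂[ε₁,ε₂]/(ε₁²,ε₂²)` with Morgan's Heisenberg traces) NEW-COMBINATION
conjecture, NOT IN PRINT, falsifier ENGINE 42; DESC-32-G/B conjecture rows = BSD₂ second digit on the family (v51 §2.3); DESC-32-P known type (Waldspurger consequence only
together with BSD-side constancy (B4) and the integrality of `g_W`).  Nearest printed OBJECT (v53 §5.1): Kiming et al. 2018 SIGMA 14, 057 (a mod-4 dc-weak eigenform of
level 1 whose `a_ℓ mod 4` is governed by `ℚ(E[4])` of a conductor-128 CM curve) — the toy model; non-semisimple mod-2 Hecke modules: Calegari–Emerton 2009, Kilford–Wiese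
2008, Kedlaya–Medvedovsky 2019; half-integral weight mod 2 beyond θ-transport: nothing found.  BC5 (MEMO-desc §32; `HOME/MEMO-desc-data/g23/`): ENGINE 34/37/39 (admissible
reading: 48 399 twins, 0 wrong under the BSD₂ dictionary DESC-30-N₀), ENGINE 40 (kit j329191, `r40-all.out` fec1eb564192648e: 24 curves, 8 324 rows, all split `p ∈ A(W)`,
`p ≤ 40 000`; three-way agreement `[v₂S = v_min] = [nsplit = 0] = [ellrank = (0,0,0)]` 2 046/2 046 on the 18 complete-triple curves, 0 contradictions on the rest).
R196c (BC5 breadth: ENGINE 41e + 43 on ≥ 2 further branch curves, one with ODD conductor, one with ≥ 2 odd bad primes) is -desc's and -data's.  Cheapest falsifier (G): one split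
`p ∈ A(W)` with `[v₂ S_W(p) = v_min(W)] ≠ [no torsor quartic of S⁻ splits mod p]`, or one admissible prime off the law.  Why novel (one sentence, -desc §32 + REF2 v53 §5.1):
«the Hecke module `R_W·Ḡ_W` of the θ-transported Waldspurger sieve is conjectured (C32) to be Morgan's Heisenberg deformation of `W[2]` plus infinitesimal genus twists» —
the governing-field reading of the BSD₂ second digit on a genus class is not in print.  PARTITION none.  Beyond-print theorem: no.  BSD is not proved; 23715 not closed.
bears_on: stmt-BirchSwinnertonDyer-23715.

## -desc's module docstring of `Sketch32v2.lean` (verbatim; cite brackets re-keyed by the typer as said above)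

# Sketch32 v2 — cell bsd-f1-sign2, seat -desc g23 (LENS descent / visibility), MEMO-desc §32; v2 = -desc g25: REF1 R196a CURRENCY RE-TYPE of DESC-32-G/B
(`#Ш_an` a non-zero RATIONAL `x` read through `padicValRat 2 x`, as in the ported §33 rows — no all-prime integrality smuggled in), R196e (`FrobTwoSplitAt` = the tree's name
for the split predicate of v1), R196b wording («always», not «when admissible primes exist»).  Statements G/B otherwise verbatim; P unchanged.

**THE ANALYTIC DEPTH BIT IS A PRIME COEFFICIENT OF A WEIGHT-2 MODULAR FORM MOD 2; THE GENUS CLASS HAS ONE GOVERNING FIELD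
(admissible primes: Frobenius order 3 | 6 — the Cassels–Tate bit; split primes: Frobenius order 4 ⟺ `Ш(W^{(−p)})[2] = 0`).**

Setting: population P2 = the rank-one odd branch `OnOddBranchRankOneAtTwo` (tree).  The GENUS CLASS `A(W)` of a curve `W` of conductor `N` is the set of
odd good primes `p` with `−p ≡ 1 (mod 8)` and `(−p/ℓ) = +1` at every odd bad `ℓ` — i.e. `DescAdmissible W (−p)` WITHOUT the parity condition on `a_p`
(`InGenusClassAtTwo`).  It is ONE adelic square class (at `2`, at every bad prime, at `∞`), so `(Δ_W/p) = +1` on it ALWAYS (reciprocity and `Δ_W > 0` on the branch; REF1 R196b):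
every `p ∈ A(W)` has `Frob_p ∈ A₃ ⊂ S₃` on `E[2]`, i.e. `p` is ADMISSIBLE (`a_p` odd, `Frob_p` a 3-cycle) or SPLIT (`E[2] ⊂ E(𝔽_p)`, tree `FrobTwoSplitAt`; then `c_p(W^{(−p)}) = 4`, else `c_p = 1`).

§32 (MEMO-desc §32; ENGINE 40 = kit j329191, 24 curves × all primes of `A(W)` up to `40 000`; ENGINE 41 = PARI half-integral weight packets):
 (a) WALDSPURGER on the class: there is an integral cusp form `g_W = Σ c(n) qⁿ` of weight `3/2` in the packet of `W` (`T_{p²} g = a_p(W) g`, `p ∤ 2N`)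
     with `c(n)² = κ_W · S_W(n)` for squarefree `n ∈ A(W)`, `S_W(n)` = the Birch modular-symbol sum of ENGINE 34/40 (`∝ L(W^{(−n)},1)√n/Ω⁻`), ONE constant
     `κ_W` for the whole class [cite: Waldspurger1981Fourier, Thm. 1] [cite: BaruchMao2007, Thm. 1.1] (arbitrary level).
     CONSEQUENCES (known type): `v₂ #Ш_an(W^{(−p)})` is EVEN on `A(W)` and `v₂ S_W(p) ≥ v₂ S_W(q₀) − 2·v₂ c(q₀)` (row DESC-32-P; ENGINE 34/40: parity constant per curve,
     11 649 + ENGINE 40 rows, 0 exceptions).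
 (b) THETA TRICK: `G_W := g_W · θ ∈ M₂(Γ₀(4N_g), ℤ)`, `θ = Σ q^{m²} ≡ 1 (mod 2)`, so `a_n(G_W) ≡ c(n) (mod 2)`.  LEMMA (P2) (elementary, §32.2): for odd
     `p ∤ N_g`, `T_p²(gθ) ≡ a_p(W)·gθ (mod 2)`; hence `Ḡ_W := G_W mod 2` satisfies `(T_p − a_p(W))² Ḡ_W = 0` for every odd `p ∤ N_g`: a GENERALIZED eigenvector
     in `S₂(Γ₀(4N_g), 𝔽₂)_𝔪`, `𝔪 = (2, T_p − a_p(W)) =` the maximal ideal of `ρ̄ = E[2]` (non-Eisenstein: `a_q ≡ 1` at 3-cycle primes).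
 (c) HECKE DETERMINANT LAW [cite: Carayol1994, Thm. 3] (Contemp. Math. 165; ρ̄ abs. irreducible, S₃ curves) [cite: Chenevier2014]
     (determinant laws, char 2, C₃ curves): `T(Frob_p) = T_p` in the finite local ring `R_W := 𝕋̄·Ḡ_W` (`𝔽₂`-dimension `d_W`), so `p ↦ a_p(Ḡ_W) = λ(T_p)` is
     FROBENIAN, governed by a number field `M_R` unramified outside `2N_g`, for ALL `p ∤ 2N_g` at once.
 (d) THE BIT: if `m_W := v₂ c(q₀) = 0` for one admissible `q₀` with Cassels–Tate bit `θ = −` (a FINITE CHECK; GKZ/Tamagawa heuristic §32.4: expected when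
     `Tam(W)·c_Manin` is odd), then on `A(W)`:  `a_p(Ḡ_W) = [v₂(c_p(W^{(−p)}) · #Ш_an(W^{(−p)})) = 2]`, i.e. for admissible `q`: `a_q(Ḡ_W) = [#Ш_an(W^{(−q)}) ≡ 4 (8)] =
     [θ(q) = −]` (BSD₂-dictionary DESC-30-N₀) and for split `p`: `a_p(Ḡ_W) = [#Ш_an(W^{(−p)}) odd] = [Sel₂(W^{(−p)}) = 0]` (BSD₂ layer 1; descent: `Sel₂(W^{(−p)}) = 0 ⟺`
     `loc_p` is injective on the constant plane `S⁻ ⟺` none of the three torsor quartics of `S⁻` splits completely mod `p`; ENGINE 40 three-way census).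
     ⇒ THEOREM-candidate B32: `m_W = 0 ⇒` the analytic depth bit is Frobenian on the WHOLE genus class, governing field unramified outside `2N`.
 (e) CONJECTURE C32 (structure, per curve a finite Hecke computation + Faltings–Serre): `R_W ≅ 𝔽₂[ε₁,ε₂]/(ε₁²,ε₂²)` and `T|_{R_W}` = the traces of MORGAN's Heisenberg
     deformation `ρ_H = ρ̄(1 + ε₁L(s₁) + ε₂L(s₂) + ε₁ε₂Z)` (`L(v)` = transvection, `S⁻ = ⟨s₁,s₂⟩`): `T_q = 1 + ε₁ε₂ψ(Frob_q)` (3-cycles), `T_p = ε₁ε₂·e₂(s₁(Frob_p), s₂(Frob_p))`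
     (split), `λ = (ε₁ε₂)^∨ + const`; so `M_R = M_W` = the `2^{1+4}_+ ⋊ G` field of §31 and the law below holds [cite: Morgan2023KummerGeneric, Prop. 19, 24, 26, 31 and Cor. 34]
     (Selmer side of the 3-cycle reading).  In `M_W` a split prime has `Frob_p` over `h = (h₁,h₂) ∈ E[2]²` with `Frob_p² = z^{Q(h)}`, `Q(h) = e₂(h₁,h₂)` (DESC-31-A), so
     `Frob_p` has order `4 ⟺ h₁, h₂` independent `⟺ Sel₂(W^{(−p)}) = 0`.

Rows (namespace `Summit.BirchSwinnertonDyer.Rank1Residual.F1Sign2`; plain `def`s state nothing; `@[conjecture]` marks the cell's candidates):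
* `InGenusClassAtTwo W p`, `DoorResidueDegree M q f` (carriers; the last as in -desc g22 Sketch31, not yet in the tree); the split predicate is the tree's `FrobTwoSplitAt W p`.
* DESC-32-G `GenusClassGoverningFieldAtTwo` (`@[conjecture]`, THE §32 TYPED CANDIDATE; analytic formulation, no BSD₂ inside): ONE Galois field `M ⊇ ℚ(E[2])`,
  `[M:ℚ] ∣ 192`, unramified outside `2Δ_W`, decides `v₂ #Ш_an` of the rank-0 twin for EVERY prime of the genus class: admissible `q`: `v₂ #Ш_an ≥ 4 ⟺ (c ⟺ f_q = 6)`;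
  split `p`: `v₂ #Ш_an = 0 ⟺ f_p = 4` (`#Ш_an` a non-zero rational; R196a currency).  BC5 = ENGINE 34/37 (admissible, 48 399 twins, 0 wrong under the BSD₂ dictionary) + ENGINE 40 (split, j329191).
  Cheapest falsifier: one split `p ∈ A(W)` with `[v₂ S_W(p) = v_min(W)] ≠ [no torsor quartic of S⁻ splits mod p]` (ENGINE 40 cross-tab), or one admissible prime off the law.
* DESC-32-P `GenusClassShaAnSquareClassAtTwo` (Waldspurger consequence, known type — the row the modular mechanism gives for free): `v₂ #Ш_an` is even on `A(W)`.
* DESC-32-B `GenusClassDepthBitFrobenianAtTwo` (`@[conjecture]` as typed; THEOREM-candidate B32 under the finite check `m_W = 0`): SOME number field and residue-degree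
  sets decide the bit on all of `A(W)` (the bare Frobenian statement; implied by DESC-32-G, `frobenian_of_governing`).
-/

open scoped Classical

open WeierstrassCurve Literature.NumberTheory.EllipticCurves NumberField

namespace Summit.BirchSwinnertonDyer.Rank1Residual.F1Sign2

/-- The GENUS CLASS `A(W)`: odd primes `p` of good reduction with `−p ≡ 1 (mod 8)` and `−p` a square modulo every odd bad prime — `DescAdmissible W (−p)`
without the parity condition on `a_p` (one adelic square class at `2`, at the bad primes and at `∞`).
(Typer -ty g19: carrier VERBATIM (Sketch32 v1 = v2 = Probe196a), REF1 §196 (A2) read-back: `= DescAdmissible W (−p)` minus «`a_p` odd»; BC7-5/6 (kernel file): the congruence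
pins `p ≡ 7 (mod 8)` (7, 23, 31 pass, 3 fails) and `p.Prime ∧ p ≠ 2`, so no row ever reads the junk `frobeniusTrace 2` / reduction at `2`.  R196b: `(Δ_W/p) = +1` on the class
always (reciprocity, `Δ_W > 0` on the branch).) -/
def InGenusClassAtTwo (W : WeierstrassCurve ℚ) [W.IsGloballyMinimal] (p : ℕ) : Prop :=
  p.Prime ∧ p ≠ 2 ∧ (-(p : ℤ)) % 8 = 1 ∧ (∀ _h : Fact p.Prime, W.HasGoodReductionAtPrime p) ∧
    (∀ ℓ : ℕ, ℓ.Prime → ℓ ≠ 2 → (∀ _h : Fact ℓ.Prime, ¬ W.HasGoodReductionAtPrime ℓ) → jacobiSym (-(p : ℤ)) ℓ = 1)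

/-- `DoorResidueDegree M q f`: every prime ideal of `𝓞 M` containing the rational prime `q` has residue field of cardinality `q ^ f` (for `M/ℚ` Galois: `Frob_q` has
order `f`).  Same body as -desc g22 `Sketch31.DoorResidueDegree`.
(Typer: carrier VERBATIM; REF1 §196 R196e: shared with -desc g22's Sketch31 (not in the tree) — it lands HERE once, later ports import it; BC7-4 (kernel file): `DoorResidueDegree M q 0`
is FALSE as soon as one prime of `𝓞 M` contains `q`, so DESC-32-B's unconstrained degrees `f₃ f₁ : ℕ` cannot trivialise the bits via `f = 0`.) -/
def DoorResidueDegree (M : Type) [Field M] [NumberField M] (q f : ℕ) : Prop :=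
  ∀ Q : Ideal (𝓞 M), Q.IsPrime → ((q : ℤ) : 𝓞 M) ∈ Q → Nat.card (𝓞 M ⧸ Q) = q ^ f

/-- **DESC-32-G `GenusClassGoverningFieldAtTwo` (`@[conjecture]`; THE §32 TYPED CANDIDATE).**  For `W` on the rank-one odd branch there are a Galois number field `M`
with `[M:ℚ] ∣ 192`, containing the `2`-division field, unramified outside `2Δ_W`, and a constant `c`, such that for EVERY prime `p` of the genus class `A(W)` and every
globally minimal model `W'` of the twin `W^{(−p)}` of analytic rank `0`, `#Ш_an(W')` is a non-zero rational `x` with (R196a currency: `v₂ = padicValRat 2`, nothing at odd primes):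
 • (`p` admissible, `a_p` odd) `v₂(x) ≥ 4 ⟺ (c ⟺` the primes of `M` over `p` have residue degree `6)` — the Cassels–Tate / depth bit (§31, Morgan's Heisenberg symbol);
 • (`p` split) `v₂(x) = 0 ⟺` the primes of `M` over `p` have residue degree `4` — `⟺ Sel₂(W^{(−p)}) = 0 ⟺ loc_p` injective on `S⁻` (descent; `Frob_p² = z^{e₂(h₁,h₂)}` in `2^{1+4}_+`).
MECHANISM (§32): `n ↦ [v₂(c_p·n) = 2]` on `A(W)` is `p ↦ a_p(Ḡ_W)`, `Ḡ_W = g_W θ mod 2 ∈ S₂(Γ₀(4N_g), 𝔽₂)[(T_p − a_p)² = 0]`, a Hecke determinant law over `R_W = 𝕋̄Ḡ_W`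
(B32: Frobenian as soon as `m_W = 0`); C32: `R_W ≅ 𝔽₂[ε₁,ε₂]/(ε₁²,ε₂²)` with Morgan's Heisenberg traces.  BC5: ENGINE 34/37/39 (admissible reading, 48 399 twins, 0 wrong
under the BSD₂ dictionary DESC-30-N₀), ENGINE 40 (split reading: kit j329191, 24 curves, all split `p ∈ A(W)`, `p ≤ 40 000`: `[v₂ S_W(p) = v_min] = [ellrank = (0,0,0)] =
[no torsor quartic of S⁻ splits mod p]`).  [cite: Morgan2023KummerGeneric, Prop. 19, 24, 26, 31 and Cor. 34] (Selmer-side law at 3-cycle primes)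
[cite: Waldspurger1981Fourier, Thm. 1] [cite: BaruchMao2007, Thm. 1.1] [cite: Carayol1994, Thm. 3] [cite: Chenevier2014]
(Typer -ty g19, REF1-AUDIT §196: **SURVIVES as `@[conjecture]`** — FILED ONLY IN REF1's MANDATORY R196a CURRENCY (applied by -desc g25 in Sketch32v2, builder-verified
= REF1's replacement text verbatim + R196e `FrobTwoSplitAt`): the v1 conclusion `∃ n : ℕ, shaAn W' = n ∧ (… 16 ∣ n …) ∧ (… Odd n …)` asserted all-prime integrality
of `#Ш_an` on the whole class (REF1 FINDINGS 32 (i), `bc7_32G_forces_integrality`); the filed `∃ x : ℚ, … x ≠ 0 ∧ (… 4 ≤ padicValRat 2 x …) ∧ (… padicValRat 2 x = 0 …)`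
keeps exactly the two bits (dictionary `bc7_nat_to_rat_currency`, kernel file).  (A2): `[M:ℚ] ∣ 192` = `|2^{1+4}_+ ⋊ S₃|`; «unramified outside `2Δ_W`» typed on
`NumberField.discr M`; `c : Prop` = the one global sign of the Cassels–Tate reading.  REF2 v53 §5: conjecture row = BSD₂ second digit on the family (v51 §2.3); its
mechanism splits as B32 (print-assembly, see DESC-32-B) + C32 (NEW-COMBINATION, not in print, falsifier ENGINE 42) + (H_min) (variant-candidate).  -desc's cite brackets
re-keyed one key per tag (typer): `BaruchMao2007` now a tree key.) -/
@[conjecture] def GenusClassGoverningFieldAtTwo : Prop :=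
  ∀ (W : WeierstrassCurve ℚ) [W.IsElliptic] [W.IsGloballyMinimal], OnOddBranchRankOneAtTwo W →
    ∃ (M : Type) (_ : Field M) (_ : NumberField M),
      IsGalois ℚ M ∧ Module.finrank ℚ M ∣ 192 ∧
      (W.twoTorsionPolynomial.toPoly.map (algebraMap ℚ M)).Splits ∧
      (∀ p : ℕ, p.Prime → (p : ℤ) ∣ NumberField.discr M → (p : ℤ) ∣ 2 * W.Δ.num) ∧
      ∃ c : Prop, ∀ p : ℕ, InGenusClassAtTwo W p →
        ∀ (W' : WeierstrassCurve ℚ) [W'.IsElliptic] [W'.IsGloballyMinimal],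
          (∃ C : VariableChange ℚ, C • W.quadraticTwist (-(p : ℚ)) = W') → W'.analyticRank = 0 →
            ∃ x : ℚ, shaAn W' = (x : ℂ) ∧ x ≠ 0 ∧
              (Odd (W.frobeniusTrace p) → (4 ≤ padicValRat 2 x ↔ (c ↔ DoorResidueDegree M p 6))) ∧
              (FrobTwoSplitAt W p → (padicValRat 2 x = 0 ↔ DoorResidueDegree M p 4))

/-- **DESC-32-B `GenusClassDepthBitFrobenianAtTwo` (`@[conjecture]` as typed; THEOREM-candidate B32 of §32 under the finite check `m_W = 0`): the bare Frobenian row.**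
Some number field `M`, constant `c` and residue degrees `f₃, f₁` decide, for every prime `p` of the genus class and every analytic-rank-0 minimal model `W'` of `W^{(−p)}`,
the bit `[v₂(c_p · #Ш_an(W')) = 2]`: `v₂ #Ш_an ≥ 4` at admissible `p` iff `(c ⟺ f_p(M) = f₃)`, `v₂ #Ш_an = 0` at split `p` iff `f_p(M) = f₁` (`#Ш_an ∈ ℚ^×`; R196a currency).
(Typer -ty g19, REF1-AUDIT §196: **SURVIVES** (`@[conjecture]`; finitely unfalsifiable alone, content = G's) — FILED ONLY IN THE R196a CURRENCY (as G).  REF2 v53 §5.0 (iii):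
B32's conclusion («`{p ∈ A(W) : v₂ S_W(p) = μ_W}` is Frobenian, governing field finite Galois unramified outside `2N·level`») is a COROLLARY OF PRINT needing neither
(P2) nor the determinant law — `G_A ∈ M₂(Γ₀(L_A), ℤ)` is an honest integral-weight form and «`p ↦ a_p mod m` is a class function of `Frob_p` in a finite Galois
`K_{f,m}/ℚ` unramified outside `m·level`» is Serre 1976 Thm 4.7 (= Ono 2001 Thm 2.2); with Waldspurger 1981 Thm 1 [cite: Waldspurger1981Fourier, Thm. 1] and the
class-constancy bookkeeping (B4) this is all of B32: PRINT-ASSEMBLY / corollary-candidate of print.  The identification of B32's Frobenian set with THIS row's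
`#Ш_an`-bits is the BSD₂ dictionary (layer 1 at split `p`, DESC-30-N₀ at admissible `p`) + (H_min) — hence `@[conjecture]`.) -/
@[conjecture] def GenusClassDepthBitFrobenianAtTwo : Prop :=
  ∀ (W : WeierstrassCurve ℚ) [W.IsElliptic] [W.IsGloballyMinimal], OnOddBranchRankOneAtTwo W →
    ∃ (M : Type) (_ : Field M) (_ : NumberField M) (c : Prop) (f₃ f₁ : ℕ),
      ∀ p : ℕ, InGenusClassAtTwo W p →
        ∀ (W' : WeierstrassCurve ℚ) [W'.IsElliptic] [W'.IsGloballyMinimal],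
          (∃ C : VariableChange ℚ, C • W.quadraticTwist (-(p : ℚ)) = W') → W'.analyticRank = 0 →
            ∃ x : ℚ, shaAn W' = (x : ℂ) ∧ x ≠ 0 ∧
              (Odd (W.frobeniusTrace p) → (4 ≤ padicValRat 2 x ↔ (c ↔ DoorResidueDegree M p f₃))) ∧
              (FrobTwoSplitAt W p → (padicValRat 2 x = 0 ↔ DoorResidueDegree M p f₁))

/-- Kernel glue: the governing-field row implies the bare Frobenian row (`f₃ = 6`, `f₁ = 4`).
(Typer: -desc's kernel glue VERBATIM (Sketch32 v1 = v2 = Probe196a but for the R196a-retyped rows it threads; REF1 §196: glue CLEAN, no sorry, hypotheses explicit).) -/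
theorem frobenian_of_governing (h : GenusClassGoverningFieldAtTwo) : GenusClassDepthBitFrobenianAtTwo := by
  intro W _ _ hW
  obtain ⟨M, hF, hN, -, -, -, -, c, hlaw⟩ := h W hW
  refine ⟨M, hF, hN, c, 6, 4, ?_⟩
  intro p hp W' _ _ hC hr
  exact hlaw p hp W' hC hr

/-- **DESC-32-P `GenusClassShaAnSquareClassAtTwo` (Waldspurger consequence; known type, support-grade).**  On the genus class the `2`-adic valuation of `#Ш_an` of the
rank-0 twin is EVEN (`c(p)² = κ_W·S_W(p)` with one `κ_W` for the class, and `v₂(c_p(W^{(−p)})) ∈ {0, 2}`).  ENGINE 34/40: parity of `v₂ S_W` constant per curve on all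
rows (11 649 admissible + the ENGINE 40 split rows), 0 exceptions.  [cite: Waldspurger1981Fourier, Thm. 1] [cite: BaruchMao2007, Thm. 1.1]
(Typer -ty g19, REF1-AUDIT §196: **SURVIVES, support-grade**, filed VERBATIM as a plain `def … : Prop` (R196e; un-gated).  R196f (wording of the label «known type»):
parity-CONSTANCY of `v₂(#Ш_an)` on the class is Waldspurger–(Baruch–Mao / Pal 2012 at `d ≡ 1 (8)`) print, but EVENNESS needs one anchor twin per class (a per-curve exact
modular-symbol value or DESC-30-N₀) — as a `∀ W` typed row this is a conjecture-grade SUPPORT statement, not a theorem.  REF2 v53 §5.5: a Waldspurger CONSEQUENCE only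
together with BSD-side constancy (B4) and the integrality of `g_W` — as a row about `shaAn` it is BSD₂-flavoured bookkeeping (known type).  Already in the R196a currency
(`∃ r : ℚ, … r ≠ 0 ∧ Even (padicValRat 2 r)`) in v1.  Cite brackets re-keyed (typer).) -/
def GenusClassShaAnSquareClassAtTwo : Prop :=
  ∀ (W : WeierstrassCurve ℚ) [W.IsElliptic] [W.IsGloballyMinimal], OnOddBranchRankOneAtTwo W →
    ∀ p : ℕ, InGenusClassAtTwo W p →
      ∀ (W' : WeierstrassCurve ℚ) [W'.IsElliptic] [W'.IsGloballyMinimal],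
        (∃ C : VariableChange ℚ, C • W.quadraticTwist (-(p : ℚ)) = W') → W'.analyticRank = 0 →
          ∃ r : ℚ, shaAn W' = (r : ℂ) ∧ r ≠ 0 ∧ Even (padicValRat 2 r)

end Summit.BirchSwinnertonDyer.Rank1Residual.F1Sign2
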